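import Literature.Probability.Percolation.MarkedLoopHolomorphicDefect
import Literature.Probability.Percolation.FiveMarkedS0HexBall1
import HarnessLib

/-!
# The re-linking index of a three-marked domain, and the NECESSITY of Khristoforov–Smirnov's relation («TRIPOD-DEFECT-INDEX»)

Topic `Literature/Probability/Percolation`; three-disorder layer, a sequel of `MarkedLoopHolomorphicDefect.lean` (TRIPOD-DEFECT § Three: for every
class weight on a three-marked domain, `Σ_i τ^i ObsW D wt v i = N_D(v) · Δ(wt)` with the RE-LINKING INDEX `N_D(v) = relinkIndex D v`). Reading the
identity with the INDICATOR weights `δ_j` (`Δ(δ_j) = τ^j`) identifies `N_D(v)` with data of the tree's `k = 3` observable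
(`KhSThreeDisorderObservable.lean`: the class counts `classCount D v i j = N_j(z_i)` at the three mid-edges `z_0, z_1, z_2` of `v`, and `Fobs`):

* `obsW_indicator_eq_classCount` — `ObsW D δ_j v i = N_j(z_i)`.
* ★ `sum_tau_classCount_eq_relinkIndex` — `Σ_i τ^i N_j(z_i) = N_D(v) · τ^j` for each class `j` (every all-sides face).
* ★★ `relinkIndex_eq_zero_iff` — **`N_D(v) = 0` iff every class count takes the SAME value at the three mid-edges of `v`** (iff `F` is locally
  constant around `v`); so (TRIPOD-DEFECT `holomorphicW_three_iff`) Khristoforov–Smirnov's relation is NECESSARY for holomorphicity at every face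
  around which `F` is not locally constant.
* ★ `sum_tau_sq_fobs_eq` — `Σ_i τ^{2i} F(z_i) = 3 · conj(N_D(v)) / 2^{#G}`: the re-linking index is (a third of the conjugate of) the discrete
  `∂`-DERIVATIVE of `F` at `v`, the companion of Lemma 4's `Σ_i τ^i F(z_i) = 0` (discrete `∂̄ F = 0`). In the scaling limit `F` is the conformal map
  onto an equilateral triangle (Smirnov's theorem, KhS21 Theorem 1; KhS §3 for `F` itself), whose derivative does not vanish inside; the lane's exact census
  (TRIPOD-DEFECT README: `N_D(v) ≠ 0` at 444/444 faces of 28 small marked domains) is the discrete shadow. Non-vanishing in general is NOT claimed —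
  and is FALSE face-by-face: behind a bottleneck (a corridor one site wide) a face may carry NO re-linking core at all, so `N_D(v) = 0` and `F` is locally
  flat there (lane census 2026-08-24, dumbbell domains: 74 of 270 faces), the discrete counterpart of the conformal map collapsing a pinched region. The lane's
  refined question: where a re-linking core exists, do the three rotation classes ever tie? (none in 1888 censused faces).

* ★★★ `§ Corner` — NECESSITY ON CONCRETE DOMAINS: if the neighbour of `v` across side `i` IS the corner face `y_a`, every re-linking core at `v`
  has first partner `a − i` (`picIdx_fst_eq_of_corner_side`), so `N_D(v) = #{re-linking cores at v} · τ^{2(a−i)}` (`relinkIndex_of_corner_side`) and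
  `N_D(v) ≠ 0` as soon as ONE re-linking core exists at `v` (`relinkIndex_ne_zero_of_corner_side`); hence ★★★ `tripodDefect_eq_zero_of_holomorphicW` /
  `holomorphicW_iff_tripodDefect_eq_zero`: on every three-marked domain with such a face and ONE such core (two disjoint strands from the other two
  neighbours of `v` to the other two corners), a three-disorder class weight is discretely holomorphic IFF it obeys Khristoforov–Smirnov's relation —
  the converse of Lemma 4 under a hypothesis dischargeable by exhibiting one edge set.

* ★★★★ `§ NecessityThree` — THE WITNESS AND THE UNCONDITIONAL CONVERSE: on the hexagon of radius 1 re-marked at three of the five marks of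
  `hexBall1Five` (HOLO-K's `exists_remark₃_of_strictMono`; corner faces `FivePoint.S0.cornerT`), the up-face `((-1,1),0)` lies across a side from
  the corner face `cornerT 2` and carries the explicit 5-bond re-linking core `ζW` (all finite checks by `decide` in the kernel: `oppFace_vW`,
  `closed_cW0/1/2`, `not_xiLinked_W`, `mem_hBonds_W`, `ζW_ne_side`, `parity_W`). Hence ★★★ `tripodDefect_eq_zero_of_forall_holomorphicW` — a
  three-disorder class weight holomorphic on EVERY three-marked domain obeys the relation — and ★★★★ `tripodLaw_iff_forall_holomorphicW`:
  **for three disorders, TRIPOD LAW ⟺ DISCRETE HOLOMORPHICITY ON EVERY THREE-MARKED DOMAIN** (⟹ Khristoforov–Smirnov's Lemma 4 / HOLO-K; ⟸ new;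
  `tripodLaw_three_iff`: at three marks the law is the single relation `Δ(wt) = 0`).

* ★★★ `§ Classification` — in Khristoforov–Smirnov's own terms: `obsW_const_eq_sum_classCount` and `holomorphic_combination_iff` — a combination
  `Σ_j c_j H_j` of the three link probabilities obeys the contour identity at every all-sides face of every three-marked domain iff
  `c₀ + τ c₁ + τ² c₂ = 0`, i.e. iff it lies in the span of the constant `Σ_j H_j` and their `F = Σ_j τ^j H_j`.

## References
* M. Khristoforov, S. Smirnov, *Percolation and O(1) loop model*, arXiv:2111.15612 (2021), §2 Definition 3 and Lemma 4 (p. 4), Theorem 1 (arXiv v1 p. 2: Smirnov's theorem, `φ` the conformal map onto an equilateral triangle).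
* B. Bollobás, O. Riordan, *Percolation*, Cambridge University Press (2006), Ch. 7 §7.2.2 (pp. 168–169: the marked hexagon), §7.2.3 p. 197 (re-marking by relabelling).

## Mathlib / tree
Tree: `MarkedLoopHolomorphicDefect.lean` (`relinkIndex`, `sum_tau_obsW_three`, `tripodDefect`), `MarkedLoopHolomorphy.lean` (`ObsW`, `GkW`),
`KhSThreeDisorderObservable.lean` (`classCount`, `Hobs`, `Fobs`, `TXb`, `InClassX`, `AllSides`, `Eminus`, `IsCoreb`, `ParityIs`), `TriHexBallDomain.lean` (`hexBall1Five`),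
`FiveMarkedS0HexBall1.lean` (`FivePoint.S0.cornerT`, `isCornerFace_iff`), `MarkedLoopSpace.lean` (`mem_hBonds`, `isCornerFace_iff_eq_yc`, `corners`), `MarkedLoopHolomorphy.lean`
(`exists_remark₃_of_strictMono`, `hBonds_eq_of_verts_eq'`). Mathlib: `Complex.ext_iff`, `Finset.sum_boole`, `map_sum`, `Fin.strictMono_castLE`, `decide`.
-/

open Finset

namespace Literature.Probability.Percolation.MarkedLoops

open Literature.Probability.Percolation Literature.Probability.LatticeModels
open Literature.Probability.Percolation.FivePoint (tau XiLinked xiDeg side)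
open Literature.Probability.Percolation.FivePoint.N5 (xiLinked_iff_reachable)
open TriMarkedDomain

section Index

variable {D : TriMarkedDomain 3}

/-- `τ² + τ + 1 = 0`. [folklore] -/
private theorem tau_sum₃ : 1 + tau + tau ^ 2 = 0 := by
  have hprim : IsPrimitiveRoot tau 3 := by
    have h := Complex.isPrimitiveRoot_exp 3 (by norm_num)
    unfold tau
    convert h using 2
    push_cast
    ring
  have h := hprim.geom_sum_eq_zero (by norm_num : 1 < 3)
  simp only [Finset.sum_range_succ, Finset.sum_range_zero, pow_zero, pow_one, zero_add] at h
  linear_combination h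

/-- `τ³ = 1`. [folklore] -/
private theorem tau_cube₃ : tau ^ 3 = 1 := by linear_combination (tau - 1) * tau_sum₃

/-- the INDICATOR class weight of class `j`. [cite: KhristoforovSmirnov2021, §2 Definition 3 (p. 4: `H_j`)] -/
noncomputable def indicatorWt (j : Fin 3) : Fin 3 → Finset (Fin 3 × Fin 3) → ℂ := fun j' _ => if j' = j then 1 else 0

/-- the indicator weight has defect `Δ(δ_j) = τ^j`. [cite: KhristoforovSmirnov2021, §2 Lemma 4 (p. 4)] -/
theorem tripodDefect_indicatorWt (j : Fin 3) : tripodDefect (indicatorWt j) 0 1 2 ∅ = tau ^ (j : ℕ) := by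
  unfold tripodDefect indicatorWt
  have h3 : ∀ j : Fin 3, j = 0 ∨ j = 1 ∨ j = 2 := by decide
  rcases h3 j with rfl | rfl | rfl
  · simp
  · simp
  · simp

open Classical in
/-- **the indicator weight's observable is the class count**: `ObsW D δ_j v i = N_j(z_i)` (both halves of the subdivided edge).
[cite: KhristoforovSmirnov2021, §2 Definition 3 (p. 4)] -/
theorem obsW_indicatorWt_eq_classCount (j : Fin 3) (v : HexVertex) (i : Fin 3) :
    ObsW D (indicatorWt j) v i = (classCount D v i j : ℂ) := by
  unfold ObsW GkW classCount indicatorWt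
  have key : ∀ (s : HexVertex) (ξ : Finset (Sym2 (Site 2))),
      (∑ j' : Fin 3, if InClassX D (faceVertex v (i + 1)) (faceVertex v (i + 2)) s j' ξ then (if j' = j then (1 : ℂ) else 0) else 0) =
        if InClassX D (faceVertex v (i + 1)) (faceVertex v (i + 2)) s j ξ then 1 else 0 := by
    intro s ξ
    rw [Finset.sum_eq_single j]
    · by_cases h : InClassX D (faceVertex v (i + 1)) (faceVertex v (i + 2)) s j ξ
      · rw [if_pos h, if_pos h, if_pos rfl]
      · rw [if_neg h, if_neg h]
    · intro j' _ hj'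
      by_cases h : InClassX D (faceVertex v (i + 1)) (faceVertex v (i + 2)) s j' ξ
      · rw [if_pos h, if_neg hj']
      · rw [if_neg h]
    · intro h; exact absurd (Finset.mem_univ j) h
  simp only [key, Finset.sum_boole, Nat.cast_add]

/-- ★ **class counts around a face**: `Σ_i τ^i N_j(z_i) = N_D(v) · τ^j` for each class `j`, at every face with three `H_G`-sides.
[cite: KhristoforovSmirnov2021, §2 Lemma 4 (p. 4) with its proof and Fig. 3] -/
theorem sum_tau_classCount_eq_relinkIndex (j : Fin 3) {v : HexVertex} (hv : AllSides D v) :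
    ∑ i : Fin 3, tau ^ (i : ℕ) * (classCount D v i j : ℂ) = relinkIndex D v * tau ^ (j : ℕ) := by
  have h := sum_tau_obsW_three (D := D) (indicatorWt j) hv
  simp only [obsW_indicatorWt_eq_classCount] at h
  rw [h, tripodDefect_indicatorWt]

/-- `τ` is not real. [folklore] -/
private theorem tau_im_ne_zero : tau.im ≠ 0 := by
  intro h0
  have hre := congrArg Complex.re tau_sum₃
  simp only [Complex.add_re, Complex.one_re, sq, Complex.mul_re, h0, mul_zero, sub_zero, Complex.zero_re] at hre
  nlinarith [sq_nonneg (tau.re + 1 / 2)]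

/-- a real combination `a + τ b + τ² c` vanishes iff `a = b = c` (the only real-linear relation among `1, τ, τ²` is `1 + τ + τ² = 0`).
[cite: KhristoforovSmirnov2021, §2 Definition 3 (p. 4: `τ = e^{2πi/3}`)] -/
theorem real_tau_combination_eq_zero_iff (a b c : ℝ) :
    (a : ℂ) + tau * b + tau ^ 2 * c = 0 ↔ a = b ∧ b = c := by
  constructor
  · intro h
    have h' : ((a - c : ℝ) : ℂ) + tau * ((b - c : ℝ) : ℂ) = 0 := by
      push_cast
      linear_combination h - (c : ℂ) * tau_sum₃
    have hre := congrArg Complex.re h'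
    have him := congrArg Complex.im h'
    simp only [Complex.add_re, Complex.add_im, Complex.ofReal_re, Complex.ofReal_im, Complex.mul_re, Complex.mul_im, Complex.zero_re,
      Complex.zero_im, mul_zero, sub_zero, zero_add] at hre him
    have hbc : b = c := by
      rcases mul_eq_zero.1 him with h1 | h1
      · exact absurd h1 tau_im_ne_zero
      · linarith
    subst hbc
    refine ⟨?_, rfl⟩
    have : a - b = 0 := by simpa using hre
    linarith
  · rintro ⟨rfl, rfl⟩
    linear_combination (a : ℂ) * tau_sum₃

/-- ★★ **WHEN THE RE-LINKING INDEX VANISHES**: `N_D(v) = 0` iff for every class `j` the count `N_j` takes the same value at the three mid-edges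
of `v` — iff Khristoforov–Smirnov's `F` is locally constant around `v`. With TRIPOD-DEFECT's `holomorphicW_three_iff`: the tripod relation
`Δ(wt) = 0` is NECESSARY for discrete holomorphicity on `D` as soon as `F` is not locally constant around some all-sides face of `D`.
[cite: KhristoforovSmirnov2021, §2 Definition 3 and Lemma 4 (p. 4)] -/
theorem relinkIndex_eq_zero_iff {v : HexVertex} (hv : AllSides D v) :
    relinkIndex D v = 0 ↔ ∀ j : Fin 3, classCount D v 0 j = classCount D v 1 j ∧ classCount D v 1 j = classCount D v 2 j := by
  constructor
  · intro h j
    have key := sum_tau_classCount_eq_relinkIndex (D := D) j hv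
    rw [h, zero_mul, Fin.sum_univ_three] at key
    simp only [Fin.val_zero, Fin.val_one, Fin.val_two, pow_zero, pow_one, one_mul] at key
    have k2 := (real_tau_combination_eq_zero_iff (classCount D v 0 j) (classCount D v 1 j) (classCount D v 2 j)).1 (by
      push_cast at key ⊢; linear_combination key)
    exact ⟨by exact_mod_cast k2.1, by exact_mod_cast k2.2⟩
  · intro h
    have key := sum_tau_classCount_eq_relinkIndex (D := D) 0 hv
    rw [Fin.sum_univ_three] at key
    simp only [Fin.val_zero, Fin.val_one, Fin.val_two, pow_zero, pow_one, one_mul, mul_one] at key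
    obtain ⟨h01, h12⟩ := h 0
    rw [h01, h12] at key
    rw [← key]
    linear_combination (classCount D v 2 0 : ℂ) * tau_sum₃

/-- ★ **THE RE-LINKING INDEX IS THE DISCRETE DERIVATIVE OF `F`**: `Σ_i τ^{2i} F(z_i) = 3 · conj(N_D(v)) / 2^{#G}` at every all-sides face — the
companion of Lemma 4's `Σ_i τ^i F(z_i) = 0`. [cite: KhristoforovSmirnov2021, §2 Definition 3 and Lemma 4 eq. (3) (p. 4); Theorem 1 (arXiv v1 p. 2: `φ` the conformal map onto an equilateral triangle)] -/
theorem sum_tau_sq_fobs_eq {v : HexVertex} (hv : AllSides D v) :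
    ∑ i : Fin 3, tau ^ (2 * (i : ℕ)) * Fobs D v i = 3 * (starRingEnd ℂ) (relinkIndex D v) / 2 ^ #D.verts := by
  -- conj of the class-count identity, summed over j with weights τ^{2j}·τ^{... }
  have hconjτ : (starRingEnd ℂ) tau = tau ^ 2 := by
    have h1 : tau * (starRingEnd ℂ) tau = 1 := by
      rw [Complex.mul_conj, Complex.normSq_eq_norm_sq]
      unfold tau
      rw [Complex.norm_exp]
      simp
    have h2 : tau * tau ^ 2 = 1 := by rw [← pow_succ']; exact tau_cube₃
    have hne : tau ≠ 0 := fun h => by rw [h, zero_mul] at h2; exact zero_ne_one h2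
    exact mul_left_cancel₀ hne (h1.trans h2.symm)
  -- N_D(v) conj, from the j-identities: conj(Σ_i τ^i C_ij) = Σ_i τ^{2i} C_ij = conj(N) τ^{2j}
  have hC : ∀ j : Fin 3, ∑ i : Fin 3, tau ^ (2 * (i : ℕ)) * (classCount D v i j : ℂ) = (starRingEnd ℂ) (relinkIndex D v) * tau ^ (2 * (j : ℕ)) := by
    intro j
    have key := congrArg (starRingEnd ℂ) (sum_tau_classCount_eq_relinkIndex (D := D) j hv)
    rw [map_sum, map_mul, map_pow, hconjτ, ← pow_mul] at key
    simp only [map_mul, map_pow, hconjτ, ← pow_mul, Complex.conj_natCast] at key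
    exact key
  have hC0 := hC 0
  have hC1 := hC 1
  have hC2 := hC 2
  simp only [Fin.sum_univ_three, Fin.val_zero, Fin.val_one, Fin.val_two] at hC0 hC1 hC2
  unfold Fobs Hobs
  push_cast
  simp only [Fin.sum_univ_three, Fin.val_zero, Fin.val_one, Fin.val_two]
  have h3 := tau_cube₃
  have h2 : (2 : ℂ) ^ #D.verts ≠ 0 := pow_ne_zero _ two_ne_zero
  field_simp
  linear_combination (hC0 + tau * hC1 + tau ^ 2 * hC2) + ((starRingEnd ℂ) (relinkIndex D v) * (tau ^ 3 + 2)) * h3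

end Index

/-! ### A face across a side from a corner: the index is the NUMBER of re-linking cores, and necessity follows from ONE core -/
section Corner

variable {D : TriMarkedDomain 3}

variable (D) in
open Classical in
/-- the NUMBER of re-linking cores at `v`. [cite: KhristoforovSmirnov2021, §2 Lemma 4, proof and Fig. 3 (p. 4: the re-linking triples at a vertex)] -/
noncomputable def relinkCount (v : HexVertex) : ℕ := ((coreSetb D v).filter fun q => IsRelinking v q).card

/-- a re-linking core witnesses `relinkCount ≠ 0`. [cite: KhristoforovSmirnov2021, §2 Lemma 4, proof and Fig. 3 (p. 4)] -/
theorem relinkCount_ne_zero_of_core {v : HexVertex} {ζ : Finset (Sym2 (Site 2))} (hq : IsCoreb D v Finset.univ ζ)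
    (hnl : ∀ i i' : Fin 3, i ≠ i' → ¬ XiLinked ζ (oppFace v i) (oppFace v i')) : relinkCount D v ≠ 0 := by
  classical
  unfold relinkCount
  rw [Finset.card_ne_zero]
  refine ⟨(Finset.univ, ζ), Finset.mem_filter.2 ⟨?_, rfl, hnl⟩⟩
  unfold coreSetb
  rw [Finset.mem_filter]
  exact ⟨Finset.mem_product.2 ⟨Finset.mem_univ _, Finset.mem_powerset.2 hq.1⟩, hq⟩

/-- the picture counts add up to the number of re-linking cores (each re-linking core has exactly one picture).
[cite: KhristoforovSmirnov2021, §2 Lemma 4, proof and Fig. 3 (p. 4); §1.2 (p. 2)] -/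
theorem sum_pictureCount_eq_relinkCount {v : HexVertex} (hv : AllSides D v) :
    ∑ P : PicIdx 3, pictureCount D v P = relinkCount D v := by
  classical
  unfold pictureCount relinkCount
  have hq' : ∀ q ∈ coreSetb D v, IsCoreb D v q.1 q.2 := fun q hq => by
    unfold coreSetb at hq
    exact (Finset.mem_filter.1 hq).2
  simp only [Finset.card_filter]
  rw [Finset.sum_comm]
  refine Finset.sum_congr rfl fun q hq => ?_
  obtain ⟨S, ζ⟩ := q
  by_cases h : IsRelinking v (S, ζ)
  · rw [if_pos h]
    obtain ⟨hS, hnl⟩ := h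
    simp only at hS hnl
    subst hS
    choose p hp using hbK_core_partners hv (hq' _ hq) hnl
    have key : ∀ P : PicIdx 3, (if HasPicture D v (Finset.univ, ζ) P then 1 else 0) = if (p 0, p 1, p 2, linkRel D ζ) = P then 1 else 0 := by
      intro P
      by_cases hP : (p 0, p 1, p 2, linkRel D ζ) = P
      · rw [if_pos hP, if_pos ((hasPicture_iff_eq hv (hq' _ hq) hnl hp P).2 hP.symm)]
      · rw [if_neg hP, if_neg (fun h => hP ((hasPicture_iff_eq hv (hq' _ hq) hnl hp P).1 h).symm)]
    rw [Finset.sum_congr rfl (fun P _ => key P), Finset.sum_ite_eq Finset.univ, if_pos (Finset.mem_univ _)]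
  · rw [if_neg h]
    refine Finset.sum_eq_zero fun P _ => ?_
    rw [if_neg (not_hasPicture_of_not_relinking h P)]

/-- ★ if the neighbour of `v` across side `i` IS the corner face `y_a`, every re-linking core at `v` reads `a` at position `i`, so its first
partner is `a - i`. [cite: KhristoforovSmirnov2021, §2 Lemma 4, proof and Fig. 3 (p. 4: a neighbour that is a corner is its own partner)] -/
theorem picIdx_fst_eq_of_corner_side {v : HexVertex} (hv : AllSides D v) {i a : Fin 3} (ha : oppFace v i = yc D a)
    {q : Finset (Fin 3) × Finset (Sym2 (Site 2))} (hq : q ∈ coreSetb D v) {P : PicIdx 3} (hP : HasPicture D v q P) : P.1 + i = a := by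
  classical
  have hcore : IsCoreb D v q.1 q.2 := by
    unfold coreSetb at hq
    exact (Finset.mem_filter.1 hq).2
  obtain ⟨⟨hS, hnl⟩, h0, h1, h2, hL⟩ := hP
  obtain ⟨S, ζ⟩ := q
  simp only at hS hnl hcore h0 h1 h2 hL
  subst hS
  choose p hp using hbK_core_partners hv hcore hnl
  have e0 : P.1 = p 0 := eq_partner_of_linked hv hcore hp h0
  have e1 : P.2.1 = p 1 := eq_partner_of_linked hv hcore hp h1
  have e2 : P.2.2.1 = p 2 := eq_partner_of_linked hv hcore hp h2
  have ea : a = p i := eq_partner_of_linked hv hcore hp ((xiLinked_iff_reachable _ _ _).2 (by rw [ha]))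
  obtain ⟨hb, hc, -⟩ := tripodPicture_three (tripodPicture_of_core hv hcore hnl hp)
  have h3 : ∀ i : Fin 3, i = 0 ∨ i = 1 ∨ i = 2 := by decide
  rcases h3 i with rfl | rfl | rfl
  · rw [add_zero, e0, ea]
  · rw [e0, ea, hb]
  · rw [e0, ea, hc]

/-- ★★ **at a face across a side from a corner, the re-linking index is the number of re-linking cores times a cube root of unity**:
`N_D(v) = #{re-linking cores at v} · τ^{2(a−i)}` when `oppFace v i = y_a`. [cite: KhristoforovSmirnov2021, §2 Lemma 4, proof and Fig. 3 (p. 4)] -/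
theorem relinkIndex_of_corner_side {v : HexVertex} (hv : AllSides D v) {i a : Fin 3} (ha : oppFace v i = yc D a) :
    relinkIndex D v = (relinkCount D v : ℂ) * tau ^ (2 * ((a - i : Fin 3) : ℕ)) := by
  unfold relinkIndex
  rw [← sum_pictureCount_eq_relinkCount hv, Nat.cast_sum, Finset.sum_mul]
  refine Finset.sum_congr rfl fun P _ => ?_
  by_cases hc : pictureCount D v P = 0
  · rw [hc, Nat.cast_zero, zero_mul, zero_mul]
  · classical
    unfold pictureCount at hc
    obtain ⟨q, hq⟩ := Finset.card_pos.1 (Nat.pos_of_ne_zero hc)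
    rw [Finset.mem_filter] at hq
    have e : P.1 = a - i := by
      have := picIdx_fst_eq_of_corner_side hv ha hq.1 hq.2
      rw [← this, add_sub_cancel_right]
    rw [e]

/-- ★★ hence `N_D(v) ≠ 0` at such a face as soon as ONE re-linking core exists there.
[cite: KhristoforovSmirnov2021, §2 Lemma 4, proof and Fig. 3 (p. 4)] -/
theorem relinkIndex_ne_zero_of_corner_side {v : HexVertex} (hv : AllSides D v) {i a : Fin 3} (ha : oppFace v i = yc D a)
    (hex : relinkCount D v ≠ 0) : relinkIndex D v ≠ 0 := by
  rw [relinkIndex_of_corner_side hv ha]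
  refine mul_ne_zero (Nat.cast_ne_zero.2 hex) (pow_ne_zero _ ?_)
  intro h
  have := tau_cube₃
  rw [h] at this
  norm_num at this

/-- ★★★ **NECESSITY OF KHRISTOFOROV–SMIRNOV'S RELATION** on every three-marked domain possessing a face `v` with three `H_G`-sides, one
of them shared with a corner face `y_a`, and ONE re-linking core at `v` (i.e. two disjoint strands from the other two neighbours of `v` to
the other two corners, avoiding the sides of `v`): a three-disorder class weight that is discretely holomorphic on such a domain satisfies
`wt 0 (12) + τ·wt 1 (20) + τ²·wt 2 (01) = 0`. [cite: KhristoforovSmirnov2021, §2 Lemma 4 (p. 4: the law ⇒ holomorphicity; this is the converse on such domains)] -/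
theorem tripodDefect_eq_zero_of_holomorphicW {v : HexVertex} (hv : AllSides D v) {i a : Fin 3} (ha : oppFace v i = yc D a)
    {ζ : Finset (Sym2 (Site 2))} (hq : IsCoreb D v Finset.univ ζ) (hnl : ∀ j j' : Fin 3, j ≠ j' → ¬ XiLinked ζ (oppFace v j) (oppFace v j'))
    {wt : Fin 3 → Finset (Fin 3 × Fin 3) → ℂ} (h : HolomorphicW D wt) : tripodDefect wt 0 1 2 ∅ = 0 := by
  rcases (holomorphicW_three_iff D wt).1 h with hΔ | hN
  · exact hΔ
  · exact absurd (hN v hv) (relinkIndex_ne_zero_of_corner_side hv ha (relinkCount_ne_zero_of_core hq hnl))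

/-- the same as an `iff` with the tripod law: on such a domain, HOLOMORPHIC ⟺ TRIPOD LAW (for three marks the law is the single relation
`Δ(wt) = 0` read three times). [cite: KhristoforovSmirnov2021, §2 Lemma 4 (p. 4)] -/
theorem holomorphicW_iff_tripodDefect_eq_zero {v : HexVertex} (hv : AllSides D v) {i a : Fin 3} (ha : oppFace v i = yc D a)
    {ζ : Finset (Sym2 (Site 2))} (hq : IsCoreb D v Finset.univ ζ) (hnl : ∀ j j' : Fin 3, j ≠ j' → ¬ XiLinked ζ (oppFace v j) (oppFace v j'))
    (wt : Fin 3 → Finset (Fin 3 × Fin 3) → ℂ) : HolomorphicW D wt ↔ tripodDefect wt 0 1 2 ∅ = 0 :=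
  ⟨tripodDefect_eq_zero_of_holomorphicW hv ha hq hnl, fun hΔ => (holomorphicW_three_iff D wt).2 (Or.inl hΔ)⟩

end Corner

/-! ### The witness: the re-marked hexagon of radius 1 — necessity for three disorders, unconditionally -/
section NecessityThree

/-- reachability stays inside a set closed under the step relation. [folklore] -/
private theorem reflTransGen_mem_of_closed {α : Type*} {R : α → α → Prop} {C : Finset α}
    (hC : ∀ a ∈ C, ∀ b, R a b → b ∈ C) {a b : α} (ha : a ∈ C) (h : Relation.ReflTransGen R a b) : b ∈ C := by
  induction h with
  | refl => exact ha
  | tail _ hbc ih => exact hC _ ih _ hbc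

/-- the witness face `v = ((-1,1), up)`. [cite: BollobasRiordan2006, Ch. 7 §7.2.2 (pp. 168–169)] -/
def vW : HexVertex := (![-1, 1], 0)

/-- the witness core: five bonds, two disjoint strands. [cite: KhristoforovSmirnov2021, §2 Lemma 4, proof and Fig. 3 (p. 4)] -/
def ζW : Finset (Sym2 (Site 2)) :=
  {s(![0, 0], ![0, 1]), s(![0, 0], ![1, 0]), s(![0, 1], ![0, 2]), s(![1, -1], ![1, 0]), s(![1, 0], ![2, -1])}

/-- the faces of the strand from `oppFace vW 0`. [cite: KhristoforovSmirnov2021, §2 Lemma 4 (p. 4)] -/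
def cW0 : Finset HexVertex := {(![-1, 1], 1), (![0, 1], 0)}
/-- the (trivial) component of `oppFace vW 1`, a corner face. [cite: KhristoforovSmirnov2021, §2 Lemma 4 (p. 4)] -/
def cW1 : Finset HexVertex := {(![-2, 1], 1)}
/-- the faces of the strand from `oppFace vW 2`. [cite: KhristoforovSmirnov2021, §2 Lemma 4 (p. 4)] -/
def cW2 : Finset HexVertex := {(![-1, 0], 1), (![0, 0], 0), (![0, -1], 1), (![1, -1], 0), (![1, -1], 1)}

/-- the three neighbours of the witness face. [cite: BollobasRiordan2006, Ch. 7 Lemma 12 p. 180] -/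
theorem oppFace_vW : oppFace vW 0 = (![-1, 1], 1) ∧ oppFace vW 1 = (![-2, 1], 1) ∧ oppFace vW 2 = (![-1, 0], 1) := by decide

/-- the first component is closed under adjacency across bonds of the core. [cite: KhristoforovSmirnov2021, §2 Lemma 4 (p. 4)] -/
theorem closed_cW0 : ∀ F ∈ cW0, ∀ j : Fin 3, s(faceVertex F (j + 1), faceVertex F (j + 2)) ∈ ζW → oppFace F j ∈ cW0 := by decide
/-- the second component is closed. [cite: KhristoforovSmirnov2021, §2 Lemma 4 (p. 4)] -/
theorem closed_cW1 : ∀ F ∈ cW1, ∀ j : Fin 3, s(faceVertex F (j + 1), faceVertex F (j + 2)) ∈ ζW → oppFace F j ∈ cW1 := by decide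
/-- the third component is closed. [cite: KhristoforovSmirnov2021, §2 Lemma 4 (p. 4)] -/
theorem closed_cW2 : ∀ F ∈ cW2, ∀ j : Fin 3, s(faceVertex F (j + 1), faceVertex F (j + 2)) ∈ ζW → oppFace F j ∈ cW2 := by decide

/-- linking inside the core stays in the component. [cite: KhristoforovSmirnov2021, §2 Lemma 4 (p. 4)] -/
theorem xiLinked_mem {C : Finset HexVertex} (hC : ∀ F ∈ C, ∀ j : Fin 3, s(faceVertex F (j + 1), faceVertex F (j + 2)) ∈ ζW → oppFace F j ∈ C)
    {Y Y' : HexVertex} (hY : Y ∈ C) (h : XiLinked ζW Y Y') : Y' ∈ C := by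
  refine reflTransGen_mem_of_closed (fun F hF F' hR => ?_) hY h
  obtain ⟨j, rfl, hj⟩ := hR
  exact hC F hF j hj

/-- no two neighbours of the witness face are linked in the witness core. [cite: KhristoforovSmirnov2021, §2 Lemma 4 (p. 4)] -/
theorem not_xiLinked_W : ∀ j j' : Fin 3, j ≠ j' → ¬ XiLinked ζW (oppFace vW j) (oppFace vW j') := by
  obtain ⟨h0, h1, h2⟩ := oppFace_vW
  have c0 := closed_cW0
  have c1 := closed_cW1
  have c2 := closed_cW2
  have m0 : oppFace vW 0 ∈ cW0 := by rw [h0]; decide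
  have m1 : oppFace vW 1 ∈ cW1 := by rw [h1]; decide
  have m2 : oppFace vW 2 ∈ cW2 := by rw [h2]; decide
  have n01 : oppFace vW 1 ∉ cW0 := by rw [h1]; decide
  have n02 : oppFace vW 2 ∉ cW0 := by rw [h2]; decide
  have n10 : oppFace vW 0 ∉ cW1 := by rw [h0]; decide
  have n12 : oppFace vW 2 ∉ cW1 := by rw [h2]; decide
  have n20 : oppFace vW 0 ∉ cW2 := by rw [h0]; decide
  have n21 : oppFace vW 1 ∉ cW2 := by rw [h1]; decide
  intro j j' hjj' h
  have h3 : ∀ i : Fin 3, i = 0 ∨ i = 1 ∨ i = 2 := by decide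
  rcases h3 j with rfl | rfl | rfl <;> rcases h3 j' with rfl | rfl | rfl
  · exact hjj' rfl
  · exact n01 (xiLinked_mem c0 m0 h)
  · exact n02 (xiLinked_mem c0 m0 h)
  · exact n10 (xiLinked_mem c1 m1 h)
  · exact hjj' rfl
  · exact n12 (xiLinked_mem c1 m1 h)
  · exact n20 (xiLinked_mem c2 m2 h)
  · exact n21 (xiLinked_mem c2 m2 h)
  · exact hjj' rfl

/-- the corner faces of `hexBall1Five` as `yc`. [cite: BollobasRiordan2006, Ch. 7 §7.2.2 pp. 168–169] -/
theorem yc_hexBall1Five (j : Fin 5) : yc hexBall1Five j = FivePoint.S0.cornerT j :=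
  (FivePoint.S0.isCornerFace_iff j _).1 ((isCornerFace_iff_eq_yc hexBall1Five).2 rfl)

/-- the witness bonds and the sides of the witness face are edges of `H_G` of the hexagon. [cite: KhristoforovSmirnov2021, §1.2 (p. 2)] -/
theorem mem_hBonds_W : (∀ b ∈ ζW, b ∈ hBonds hexBall1Five) ∧ ∀ i : Fin 3, side vW i ∈ hBonds hexBall1Five := by
  constructor
  · intro b hb
    simp only [ζW, Finset.mem_insert, Finset.mem_singleton] at hb
    rcases hb with rfl | rfl | rfl | rfl | rfl
    · exact mem_hBonds hexBall1Five (by decide) (by decide)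
    · exact mem_hBonds hexBall1Five (by decide) (by decide)
    · exact mem_hBonds hexBall1Five (by decide) (by decide)
    · exact mem_hBonds hexBall1Five (by decide) (by decide)
    · exact mem_hBonds hexBall1Five (by decide) (by decide)
  · intro i
    have h3 : ∀ i : Fin 3, i = 0 ∨ i = 1 ∨ i = 2 := by decide
    unfold side
    rcases h3 i with rfl | rfl | rfl
    · exact mem_hBonds hexBall1Five (by decide) (by decide)
    · exact mem_hBonds hexBall1Five (by decide) (by decide)
    · exact mem_hBonds hexBall1Five (by decide) (by decide)

/-- the witness bonds avoid the sides of the witness face. [cite: KhristoforovSmirnov2021, §2 Lemma 4 (p. 4)] -/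
theorem ζW_ne_side : ∀ b ∈ ζW, ∀ j : Fin 3, b ≠ side vW j := by unfold side; decide

/-- the parity profile of the witness core: odd faces = the two far corners and the two non-corner neighbours of `v`.
[cite: KhristoforovSmirnov2021, §2 Lemma 4, proof and Fig. 3 (p. 4)] -/
theorem parity_W : ∀ F ∈ triFacesTouching (triBall 1), Odd (xiDeg ζW F) ↔
    F ∈ symmDiff ((Finset.univ : Finset (Fin 3)).image fun t => FivePoint.S0.cornerT (Fin.castLE (by norm_num) t))
      ((Finset.univ : Finset (Fin 3)).image (oppFace vW)) := by
  have key : ∀ F ∈ triFacesTouching (triBall 1), (xiDeg ζW F % 2 = 1) ↔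
      F ∈ symmDiff ((Finset.univ : Finset (Fin 3)).image fun t => FivePoint.S0.cornerT (Fin.castLE (by norm_num) t))
        ((Finset.univ : Finset (Fin 3)).image (oppFace vW)) := by
    decide
  intro F hF
  rw [← key F hF, Nat.odd_iff]

/-- ★★★ **NECESSITY FOR THREE DISORDERS**: a three-disorder class weight that is discretely holomorphic on EVERY three-marked domain obeys
Khristoforov–Smirnov's relation `wt 0 (12) + τ·wt 1 (20) + τ²·wt 2 (01) = 0` (witness: the re-marked hexagon of radius 1).
[cite: KhristoforovSmirnov2021, §2 Lemma 4 (p. 4: sufficiency); BollobasRiordan2006, Ch. 7 §7.2.2 (pp. 168–169)] -/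
theorem tripodDefect_eq_zero_of_forall_holomorphicW (wt : Fin 3 → Finset (Fin 3 × Fin 3) → ℂ)
    (h : ∀ D : TriMarkedDomain 3, HolomorphicW D wt) : tripodDefect wt 0 1 2 ∅ = 0 := by
  classical
  -- the re-marked hexagon
  have hc : StrictMono (fun t : Fin 3 => (Fin.castLE (by norm_num) t : Fin 5)) := Fin.strictMono_castLE (by norm_num)
  obtain ⟨D₃, hV, hyc⟩ := exists_remark₃_of_strictMono hexBall1Five _ hc
  have hVb : D₃.verts = triBall 1 := hV
  have hH : hBonds D₃ = hBonds hexBall1Five := hBonds_eq_of_verts_eq' hexBall1Five hV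
  have hcorners : corners D₃ = (Finset.univ : Finset (Fin 3)).image fun t => FivePoint.S0.cornerT (Fin.castLE (by norm_num) t) := by
    unfold corners
    refine Finset.image_congr fun t _ => ?_
    rw [hyc, yc_hexBall1Five]
  -- the hypotheses of § Corner
  have hv : AllSides D₃ vW := fun i => by rw [hH]; exact mem_hBonds_W.2 i
  have ha : oppFace vW 1 = yc D₃ 2 := by rw [hyc, yc_hexBall1Five, oppFace_vW.2.1]; decide
  have hq : IsCoreb D₃ vW Finset.univ ζW := by
    refine ⟨fun b hb => ?_, by decide, ?_⟩
    · unfold Eminus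
      rw [Finset.mem_filter, hH]
      exact ⟨mem_hBonds_W.1 b hb, ζW_ne_side b hb⟩
    · intro F hF
      rw [hVb] at hF
      rw [hcorners]
      exact parity_W F hF
  exact tripodDefect_eq_zero_of_holomorphicW hv ha hq not_xiLinked_W (h D₃)

/-- at three marks the tripod law is the single relation `Δ(wt) = 0`. [cite: KhristoforovSmirnov2021, §2 Lemma 4, proof and Fig. 3 (p. 4)] -/
theorem tripodLaw_three_iff (wt : Fin 3 → Finset (Fin 3 × Fin 3) → ℂ) : TripodLaw wt ↔ tripodDefect wt 0 1 2 ∅ = 0 := by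
  rw [tripodLaw_iff_tripodDefect]
  constructor
  · intro h
    refine h 0 1 2 ∅ ⟨by unfold CcwTriple; decide, fun a b h => by simp at h, fun a h => by simp at h, fun a b h => by simp at h,
      fun a h0 h1 h2 => ?_, fun x y z w _ h => by simp at h⟩
    exact absurd rfl ((by decide : ∀ a : Fin 3, a ≠ 0 → a ≠ 1 → a ≠ 2 → a ≠ a) a h0 h1 h2)
  · intro h α β γ L₀ hP
    obtain ⟨hb, hc, hL⟩ := tripodPicture_three hP
    subst hb hc hL
    rw [tripodDefect_three, h, mul_zero]

/-- ★★★ **THREE DISORDERS: TRIPOD LAW ⟺ DISCRETE HOLOMORPHICITY ON EVERY THREE-MARKED DOMAIN.** The forward implication is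
Khristoforov–Smirnov's Lemma 4 for class weights (HOLO-K); the converse is the necessity above.
[cite: KhristoforovSmirnov2021, §2 Lemma 4 (p. 4)] -/
theorem tripodLaw_iff_forall_holomorphicW (wt : Fin 3 → Finset (Fin 3 × Fin 3) → ℂ) :
    TripodLaw wt ↔ ∀ D : TriMarkedDomain 3, HolomorphicW D wt :=
  ⟨fun h D => holomorphicW_of_tripodLaw' D h, fun h => (tripodLaw_three_iff wt).2 (tripodDefect_eq_zero_of_forall_holomorphicW wt h)⟩

end NecessityThree

/-! ### In Khristoforov–Smirnov's own terms: which combinations `Σ_j c_j H_j` are discretely holomorphic everywhere -/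
section Classification

/-- the observable of the constant-in-`L` class weight `c` is the combination `Σ_j c_j N_j(z_i)` of the class counts.
[cite: KhristoforovSmirnov2021, §2 Definition 3 (p. 4: `H_j`, `F = Σ_j τ^j H_j`)] -/
theorem obsW_const_eq_sum_classCount {D : TriMarkedDomain 3} (c : Fin 3 → ℂ) (v : HexVertex) (i : Fin 3) :
    ObsW D (fun (j : Fin 3) (_ : Finset (Fin 3 × Fin 3)) => c j) v i = ∑ j : Fin 3, c j * (classCount D v i j : ℂ) := by
  classical
  have hfun : (fun (j : Fin 3) (_ : Finset (Fin 3 × Fin 3)) => c j) =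
      fun (j : Fin 3) (L : Finset (Fin 3 × Fin 3)) => ∑ j' : Fin 3, c j' * indicatorWt j' j L := by
    funext j L
    unfold indicatorWt
    rw [Finset.sum_eq_single j]
    · rw [if_pos rfl, mul_one]
    · intro j' _ hj'
      rw [if_neg (Ne.symm hj'), mul_zero]
    · intro h; exact absurd (Finset.mem_univ j) h
  rw [hfun]
  have hG : ∀ (s : HexVertex) (ξ : Finset (Sym2 (Site 2))),
      GkW (D := D) (fun (j : Fin 3) (L : Finset (Fin 3 × Fin 3)) => ∑ j' : Fin 3, c j' * indicatorWt j' j L) v i s ξ =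
        ∑ j' : Fin 3, c j' * GkW (D := D) (indicatorWt j') v i s ξ := by
    intro s ξ
    unfold GkW
    have step : ∀ j : Fin 3, (if InClassX D (faceVertex v (i + 1)) (faceVertex v (i + 2)) s j ξ then
        (fun (j : Fin 3) (L : Finset (Fin 3 × Fin 3)) => ∑ j' : Fin 3, c j' * indicatorWt j' j L) j (linkRel D ξ) else 0) =
        ∑ j' : Fin 3, c j' * (if InClassX D (faceVertex v (i + 1)) (faceVertex v (i + 2)) s j ξ then indicatorWt j' j (linkRel D ξ) else 0) := by
      intro j
      by_cases h : InClassX D (faceVertex v (i + 1)) (faceVertex v (i + 2)) s j ξ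
      · simp only [if_pos h]
      · simp only [if_neg h, mul_zero, Finset.sum_const_zero]
    simp only [step]
    rw [Finset.sum_comm]
    simp only [← Finset.mul_sum]
  unfold ObsW
  simp only [hG, Finset.sum_comm (s := TXb D v i v), Finset.sum_comm (s := TXb D v i (oppFace v i)), ← Finset.mul_sum,
    ← Finset.sum_add_distrib, ← mul_add]
  refine Finset.sum_congr rfl fun j' _ => ?_
  rw [← obsW_indicatorWt_eq_classCount]
  rfl

/-- ★★★ **CLASSIFICATION IN KHRISTOFOROV–SMIRNOV'S TERMS**: a linear combination `Σ_j c_j H_j` of the three link probabilities of a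
three-disorder loop ensemble satisfies the contour identity `Σ_i τ^i (Σ_j c_j N_j(z_i)) = 0` at every all-sides face of EVERY three-marked
domain iff `c₀ + τ c₁ + τ² c₂ = 0` — i.e. iff `(c₀, c₁, c₂)` lies in the plane spanned by `(1, 1, 1)` (the constant `Σ_j H_j`) and
`(1, τ, τ²)` (their `F`). [cite: KhristoforovSmirnov2021, §2 Definition 3 and Lemma 4 (p. 4)] -/
theorem holomorphic_combination_iff (c : Fin 3 → ℂ) :
    (∀ D : TriMarkedDomain 3, ∀ v : HexVertex, AllSides D v →
        ∑ i : Fin 3, tau ^ (i : ℕ) * ∑ j : Fin 3, c j * (classCount D v i j : ℂ) = 0) ↔ c 0 + tau * c 1 + tau ^ 2 * c 2 = 0 := by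
  have key := tripodLaw_iff_forall_holomorphicW (fun (j : Fin 3) (_ : Finset (Fin 3 × Fin 3)) => c j)
  rw [tripodLaw_three_iff] at key
  unfold tripodDefect at key
  simp only at key
  rw [key]
  unfold HolomorphicW
  simp only [obsW_const_eq_sum_classCount]

end Classification

end Literature.Probability.Percolation.MarkedLoops
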